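import Summits.Ventures.DiscreteObjects.PP12.PrimeOrderSummary
import Summits.Ventures.DiscreteObjects.PP12.OrderFive

/-!
# PP(12): prime-order collineations — capstone including the order-5 Fano structure
Framing: lottery ticket; floor = certified bounds/negative ranges.

`prime_order_structure_order12'` refines `prime_order_structure_order12` (p220334) with `OrderFive` (p220694):
for a projective plane of order 12 and `σ ≠ 1` with `σ ^ p = 1` on points, `p` prime:
`p ∈ {2, 3}`, or `p = 5` and the fixed structure is a Fano subplane (7 points, 7 lines, 3/3), or `p = 11` and `σ` is
a homology (14 fixed points) or of triangle type (3 fixed points, 3 fixed lines, 2 per fixed line), or `p = 13` and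
`σ` fixes exactly an antiflag, or `p = 157` and `σ` is fixed-point-free. (`p = 7` cannot occur: `NoOrderSeven`.)
Everything here is kernel-checked; what is NOT: see `PrimeOrderSummary` (normal forms / census emptiness / `p = 5`
elimination / difference-set reformulation). Cell pub-namedobj, target M.
-/

namespace Summit.Ventures.DiscreteObjects.PP12

open Configuration Finset
open scoped Classical

namespace Collineation

variable {P L : Type*} [Membership P L] [ProjectivePlane P L] [Fintype P] [Fintype L]
  [DecidableEq P] [DecidableEq L] (σ : Collineation P L)

/-- **Prime-order collineations of a projective plane of order 12 (with the order-5 Fano structure).** -/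
theorem prime_order_structure_order12' (h12 : ProjectivePlane.order P L = 12) (hne : σ.onPoints ≠ 1) {p : ℕ}
    (hp : p.Prime) (hq : σ.onPoints ^ p = 1) :
    p = 2 ∨ p = 3 ∨
    (p = 5 ∧ fixedCard σ.onPoints = 7 ∧ fixedCard σ.onLines = 7 ∧
      (∀ l : L, σ.onLines l = l → σ.fixedOnLine l = 3) ∧ (∀ x : P, σ.onPoints x = x → σ.fixedThrough x = 3)) ∨
    (p = 11 ∧ ((∃ (l : L) (c : P), σ.IsAxis l ∧ σ.IsCenter c ∧ c ∉ l ∧ fixedCard σ.onPoints = 14) ∨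
      (fixedCard σ.onPoints = 3 ∧ fixedCard σ.onLines = 3 ∧
        ∀ l : L, σ.onLines l = l → ∀ [DecidablePred (· ∈ l)], σ.fixedOnLine l = 2))) ∨
    (p = 13 ∧ (∃! x : P, σ.onPoints x = x) ∧ (∃! l : L, σ.onLines l = l) ∧
      ∀ (x : P) (l : L), σ.onPoints x = x → σ.onLines l = l → x ∉ l) ∨
    (p = 157 ∧ fixedCard σ.onPoints = 0) := by
  rcases σ.prime_order_structure_order12 h12 hne hp hq with h | h | h | h | h | h
  · exact Or.inl h
  · exact Or.inr (Or.inl h)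
  · subst h
    exact Or.inr (Or.inr (Or.inl ⟨rfl, σ.fano_of_pow_five h12 hne hq⟩))
  · exact Or.inr (Or.inr (Or.inr (Or.inl h)))
  · exact Or.inr (Or.inr (Or.inr (Or.inr (Or.inl h))))
  · exact Or.inr (Or.inr (Or.inr (Or.inr (Or.inr h))))

end Collineation

end Summit.Ventures.DiscreteObjects.PP12
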